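import Summits.CriticalPhenomena.SAWScalingLimit.Theses.SAWDefectDecoherence
import Literature.Probability.RandomPlanarGeometry.SAWEdgeListSurgery

/-!
# `BoundaryClosureR`, line `pick-half-plane`, stub `stub_identification`: reciprocity of the
# arrival masses `Z_a(z) = Z_z(a)` (reverse the walk)

Support file for the crux `BoundaryClosureR` (stmt-CriticalPhenomena-14004) of route
`SAWDefectDecoherence`, line `pick-half-plane`, stub `stub_identification` (identification of
the Pick–cup limits = the sibling line `two-root-quotient`'s closing argument, whose one exact
lattice input besides the two-root arc constancy is RECIPROCITY: the arrival mass
`Z_x(y_δ) = Σ_{γ : x_δ → y_δ} x_c^{ℓ(γ)}` is symmetric in the two boundary mid-edges, "reverse the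
walk").  We prove it as an identity of the tree's observable at spin `σ = 0`:

* `zipWith_sym2_reverse` — the consecutive unordered pairs of a reversed vertex list are the
  reversed consecutive pairs;
* `hexParafermionicObservable_zero_symm` — for mid-edges `a, z` of the domain and every fugacity
  `x`, `F_{x,0}^{a}(z) = F_{x,0}^{z}(a)`: reversal of the vertex list is a bijection
  `HexMidEdgeSAW Λ a z → HexMidEdgeSAW Λ z a` preserving the number of visited vertices, and the
  spin-`0` weight is `x^{ℓ}`.  (Both mid-edge hypotheses are needed: a walk may only START at a
  mid-edge of the domain, `HexMidEdgeSAW.fst_mem`.)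

No new definitions (the reversal is built inside the proof).  Madras–Slade, *The Self-Avoiding
Walk* (1993), §1.2 (reversal symmetry of `c_N(x, y)`); Duminil-Copin–Smirnov (2012), §1–2.
-/

noncomputable section

open scoped BigOperators
open Literature.Probability.LatticeModels Literature.Probability.RandomPlanarGeometry
open Literature.Probability.RandomPlanarGeometry.SAW

namespace Summit.CriticalPhenomena.SAWScalingLimit.Theorems.PickHalfPlane.Identification

/-- The consecutive unordered pairs of a reversed list are the consecutive pairs, reversed
(`s(u, w) = s(w, u)`). [folklore] -/
theorem zipWith_sym2_reverse {V : Type*} : ∀ l : List V,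
    List.zipWith (fun u w => s(u, w)) l.reverse l.reverse.tail =
      (List.zipWith (fun u w => s(u, w)) l l.tail).reverse
  | [] => rfl
  | [x] => rfl
  | x :: y :: l => by
    have ih := zipWith_sym2_reverse (y :: l)
    have hlast : (y :: l).reverse.getLast? = some y := by rw [List.getLast?_reverse]; rfl
    rw [List.reverse_cons (a := x), edges_concat hlast x, ih, edges_cons_cons, List.reverse_cons,
      Sym2.eq_swap]

/-- **Reciprocity of the arrival masses** (`Z_a(z) = Z_z(a)`): for two mid-edges `a, z` of a
hexagonal domain `Λ` and any fugacity `x`, the spin-`0` observables agree,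
`Σ_{γ : a → z} x^{ℓ(γ)} = Σ_{γ : z → a} x^{ℓ(γ)}` — reversing the list of visited vertices is a
bijection between the two families of self-avoiding walks between mid-edges which preserves the
number of visited vertices (and the spin-`0` weight `e^{-i·0·W} x^ℓ = x^ℓ` ignores the winding).
Madras–Slade (1993), §1.2; Duminil-Copin–Smirnov (2012), §2. [folklore] -/
theorem hexParafermionicObservable_zero_symm : ∀ (Λ : Finset HexVertex) (a z : Sym2 HexVertex),
    a ∈ hexDomainMidEdges Λ → z ∈ hexDomainMidEdges Λ → ∀ x : ℝ,
    hexParafermionicObservable Λ a x 0 z = hexParafermionicObservable Λ z x 0 a := by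
  intro Λ a z ha hz x
  classical
  -- reversal of a walk between mid-edges (the target must be a mid-edge of the domain)
  have rev : ∀ {p q : Sym2 HexVertex}, q ∈ hexDomainMidEdges Λ →
      ∀ γ : HexMidEdgeSAW Λ p q, ∃ γ' : HexMidEdgeSAW Λ q p, γ'.verts = γ.verts.reverse := by
    intro p q hq γ
    refine ⟨{ verts := γ.verts.reverse
              subset := fun v hv => γ.subset v (List.mem_reverse.1 hv)
              nodup := List.nodup_reverse.2 γ.nodup
              isChain := List.isChain_reverse.2 (γ.isChain.imp fun _ _ h => h.symm)
              head_mem := fun v hv => γ.getLast_mem v (by rwa [List.head?_reverse] at hv)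
              getLast_mem := fun v hv => γ.head_mem v (by rwa [List.getLast?_reverse] at hv)
              eq_of_nil := fun h => (γ.eq_of_nil (List.reverse_eq_nil_iff.1 h)).symm
              edges_nodup := fun hne => ?_
              fst_mem := hq }, rfl⟩
    have hne' : γ.verts ≠ [] := fun h => hne (by rw [h]; rfl)
    have h0 := γ.edges_nodup hne'
    rw [zipWith_sym2_reverse]
    have : q :: (List.zipWith (fun u w => s(u, w)) γ.verts γ.verts.tail).reverse ++ [p] =
        (p :: List.zipWith (fun u w => s(u, w)) γ.verts γ.verts.tail ++ [q]).reverse := by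
      simp
    rw [this]
    exact List.nodup_reverse.2 h0
  choose R hR using fun γ : HexMidEdgeSAW Λ a z => rev hz γ
  choose R' hR' using fun γ : HexMidEdgeSAW Λ z a => rev ha γ
  have hRR' : ∀ γ, R' (R γ) = γ := fun γ => HexMidEdgeSAW.ext (by rw [hR', hR, List.reverse_reverse])
  have hR'R : ∀ γ, R (R' γ) = γ := fun γ => HexMidEdgeSAW.ext (by rw [hR, hR', List.reverse_reverse])
  have hbij : Function.Bijective R :=
    Function.bijective_iff_has_inverse.2 ⟨R', hRR', hR'R⟩
  unfold hexParafermionicObservable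
  refine Fintype.sum_bijective R hbij _ _ fun γ => ?_
  simp only [HexMidEdgeSAW.weight, HexMidEdgeSAW.length, hR, List.length_reverse,
    Complex.ofReal_zero, mul_zero, zero_mul]

end Summit.CriticalPhenomena.SAWScalingLimit.Theorems.PickHalfPlane.Identification

end
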